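import Literature.AnabelianGeometry.SemiGraphs.CoveringGraphConnected
import Literature.AnabelianGeometry.SemiGraphs.CoveringGraphEquiv
import Literature.AnabelianGeometry.SemiGraphs.TemperedCoveringsRestrict
import Literature.AnabelianGeometry.SemiGraphs.OncePuncturedTemperedGroupWitness
import HarnessLib

/-!
# Hypotheses of Prop 3.6 / Thm 3.7 inherited by a covering semi-graph of anabelioids — the easy fields

Mochizuki, *Semi-graphs of anabelioids*, Publ. RIMS **42** (2006), §2 Rmk. 2.4.1 p. 26 (the hypotheses
of §2 "one verifies easily" pass to finite étale coverings) and §3 Def. 3.5 (i) p. 37 (the covering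
semi-graph of anabelioids `G_S → G` of an object `S` of `B^cov(G)`) [cite: MochizukiSemiAnbd2006,
Rmk 2.4.1 p.26].  For `G_S = CovObj.coveringGraph S` — constituents = OPEN STABILISERS of base points of
orbits, branch maps = conjugated restrictions — the following standing hypotheses of Prop. 3.6 / Thm. 3.7
are inherited from `G` (route T, brick T7a; the remaining fields quasi-coherent / totally elevated /
Galois-countable / aloof / estranged are bricks T7b–d):

* `isGraph_coveringGraph`, `hasVertex_coveringGraph`, `isCountable_coveringGraph`,
* `isOfInjectiveType_coveringGraph`, `isVerticiallySlim_coveringGraph`,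
* `isConnected_coveringGraph` (a connected object of `B^temp(G)` has a connected covering semi-graph —
  converse of `CoveringGraphConnected`).

Proof-only (abc-iut cell, L3 route T, brick T7a); nothing here bears on [IUTchIII] Cor. 3.12.
-/

namespace Literature.AnabelianGeometry.SemiGraphs

namespace ProfiniteSemiGraph

namespace CovObj

open Literature.AlgebraicGeometry.Frobenioids (IsConnectedObj IsSlimGroup)
open Literature.AlgebraicGeometry.Frobenioids.QuasiTemperoid.BTempConnected (nonempty_of_isConnectedObj)

universe u

variable {𝒢 : ProfiniteSemiGraph.{u}} (S : CovObj 𝒢)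

/-! ### Graph, vertex, countability -/

/-- The covering semi-graph of a GRAPH of anabelioids is a graph: every branch `(b, ω)` abuts (to the
vertex-orbit glued from `ω`). [cite: MochizukiSemiAnbd2006, Def 3.5(i) p.37] -/
theorem isGraph_coveringGraph (h : 𝒢.IsGraph) : S.coveringGraph.IsGraph := by
  refine ⟨?_⟩
  rintro ⟨b, ω⟩
  obtain ⟨v, hv⟩ := Option.isSome_iff_exists.mp (h.abuts_isSome b)
  rw [S.coveringAbuts_eq hv ω]
  rfl

/-- `G_S` has a vertex as soon as some vertex fibre of `S` is nonempty. [cite: MochizukiSemiAnbd2006, Def 3.5(i) p.37] -/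
theorem hasVertex_coveringGraph {v : 𝒢.graph.Vertex} (x : (S.SV v).obj.V) : S.coveringGraph.HasVertex :=
  ⟨⟨v, BTemp.cl (S.SV v) x⟩⟩

/-- The covering semi-graph of a countable `G` is countable (the fibres of an object of `B^cov(G)`
are countable sets). [cite: MochizukiSemiAnbd2006, Def 3.5(i) p.37] -/
theorem isCountable_coveringGraph (h : 𝒢.IsCountable) : S.coveringGraph.IsCountable := by
  haveI := h.countable_vertex
  haveI := h.countable_edge
  haveI : ∀ v : 𝒢.graph.Vertex, Countable (BTemp.Orbits (S.SV v)) := fun v => by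
    haveI : Countable (S.SV v).obj.V := (S.SV v).property.1
    exact Quot.mk_surjective.countable
  haveI : ∀ e : 𝒢.graph.Edge, Countable (BTemp.Orbits (S.SE e)) := fun e => by
    haveI : Countable (S.SE e).obj.V := (S.SE e).property.1
    exact Quot.mk_surjective.countable
  exact ⟨inferInstanceAs (Countable (Σ v : 𝒢.graph.Vertex, BTemp.Orbits (S.SV v))),
    inferInstanceAs (Countable (Σ e : 𝒢.graph.Edge, BTemp.Orbits (S.SE e)))⟩

/-! ### Injective type, verticial slimness -/

/-- The covering semi-graph of a `G` of injective type is of injective type: its branch maps are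
conjugated restrictions of the `b_*`. [cite: MochizukiSemiAnbd2006, Rmk 2.4.1 p.26] -/
theorem isOfInjectiveType_coveringGraph (h : 𝒢.IsOfInjectiveType) : S.coveringGraph.IsOfInjectiveType := by
  rintro ⟨b, ω⟩ ⟨v, ωv⟩ hab k k' hkk'
  apply Subtype.ext
  have e := congrArg Subtype.val hkk'
  change S.conjugator hab * 𝒢.brHom b v _ k * (S.conjugator hab)⁻¹ =
    S.conjugator hab * 𝒢.brHom b v _ k' * (S.conjugator hab)⁻¹ at e
  exact h b v _ (mul_left_cancel (mul_right_cancel e))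

/-- The covering semi-graph of a verticially slim `G` is verticially slim: open subgroups of slim
profinite groups are slim. [cite: MochizukiSemiAnbd2006, Rmk 2.4.1 p.26] -/
theorem isVerticiallySlim_coveringGraph (h : 𝒢.IsVerticiallySlim) : S.coveringGraph.IsVerticiallySlim := by
  rintro ⟨v, ω⟩
  exact isSlimGroup_subgroup_of_isOpen (h v) _ ((S.SV v).property.2 _)

/-! ### Connectedness (converse of `CoveringGraphConnected`) -/

/-- Generating steps of `SameComponent` join nodes of the covering semi-graph that are reachable in
its barycentric subdivision (vertex/edge moves do not change the node; a gluing step is the 2-step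
path edge – branch – vertex). [cite: MochizukiSemiAnbd2006, Def 3.5(ii) p.37] -/
theorem reachable_of_adj {p q : S.Point} (h : S.Adj p q) :
    S.coveringSemiGraph.subdivision.Reachable
      (Sum.elim (fun x => Sum.inl ⟨x.1, BTemp.cl (S.SV x.1) x.2⟩)
        (fun y => Sum.inr (Sum.inl ⟨y.1, BTemp.cl (S.SE y.1) y.2⟩)) p)
      (Sum.elim (fun x => Sum.inl ⟨x.1, BTemp.cl (S.SV x.1) x.2⟩)
        (fun y => Sum.inr (Sum.inl ⟨y.1, BTemp.cl (S.SE y.1) y.2⟩)) q) := by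
  cases h with
  | vertex v g x =>
    change S.coveringSemiGraph.subdivision.Reachable (Sum.inl ⟨v, BTemp.cl (S.SV v) x⟩)
      (Sum.inl ⟨v, BTemp.cl (S.SV v) ((S.SV v).obj.ρ g x)⟩)
    rw [BTemp.cl_ρ]
  | edge e g x =>
    change S.coveringSemiGraph.subdivision.Reachable (Sum.inr (Sum.inl ⟨e, BTemp.cl (S.SE e) x⟩))
      (Sum.inr (Sum.inl ⟨e, BTemp.cl (S.SE e) ((S.SE e).obj.ρ g x)⟩))
    rw [BTemp.cl_ρ]
  | glue b v hb x =>
    change S.coveringSemiGraph.subdivision.Reachable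
      (Sum.inr (Sum.inl ⟨𝒢.graph.edgeOf b, BTemp.cl (S.SE (𝒢.graph.edgeOf b)) x⟩))
      (Sum.inl ⟨v, BTemp.cl (S.SV v) ((S.glue b v hb).hom.hom.hom x)⟩)
    -- edge – branch – vertex
    let β : S.coveringSemiGraph.Branch := ⟨b, BTemp.cl (S.SE (𝒢.graph.edgeOf b)) x⟩
    have h1 : S.coveringSemiGraph.subdivision.Adj (Sum.inr (Sum.inl (S.coveringSemiGraph.edgeOf β)))
        (Sum.inr (Sum.inr β)) := by
      rw [SemiGraph.subdivision, SimpleGraph.fromRel_adj]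
      exact ⟨by simp, Or.inl (SemiGraph.NodeRel.edge_branch β)⟩
    have habuts : S.coveringSemiGraph.abuts β =
        some ⟨v, BTemp.cl (S.SV v) ((S.glue b v hb).hom.hom.hom x)⟩ := by
      rw [S.coveringAbuts_eq hb]
      rfl
    have h2 : S.coveringSemiGraph.subdivision.Adj (Sum.inr (Sum.inr β))
        (Sum.inl ⟨v, BTemp.cl (S.SV v) ((S.glue b v hb).hom.hom.hom x)⟩) := by
      rw [SemiGraph.subdivision, SimpleGraph.fromRel_adj]
      exact ⟨by simp, Or.inl (SemiGraph.NodeRel.branch_vertex β _ habuts)⟩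
    exact (h1.reachable).trans h2.reachable

/-- Points in one component have reachable nodes. [cite: MochizukiSemiAnbd2006, Def 3.5(ii) p.37] -/
theorem reachable_of_sameComponent {p q : S.Point} (h : S.SameComponent p q) :
    S.coveringSemiGraph.subdivision.Reachable
      (Sum.elim (fun x => Sum.inl ⟨x.1, BTemp.cl (S.SV x.1) x.2⟩)
        (fun y => Sum.inr (Sum.inl ⟨y.1, BTemp.cl (S.SE y.1) y.2⟩)) p)
      (Sum.elim (fun x => Sum.inl ⟨x.1, BTemp.cl (S.SV x.1) x.2⟩)
        (fun y => Sum.inr (Sum.inl ⟨y.1, BTemp.cl (S.SE y.1) y.2⟩)) q) := by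
  induction h with
  | rel _ _ h => exact S.reachable_of_adj h
  | refl _ => exact SimpleGraph.Reachable.refl _
  | symm _ _ _ ih => exact ih.symm
  | trans _ _ _ _ _ ih₁ ih₂ => exact ih₁.trans ih₂

/-- **A connected object of `B^temp(G)` has a connected covering semi-graph** (converse of
`isConnectedObj_of_isConnected_coveringGraph`). [cite: MochizukiSemiAnbd2006, Def 3.5(ii) p.37] -/
theorem isConnected_coveringGraph (hS : S.IsTempered) (hSc : IsConnectedObj (⟨S, hS⟩ : BTempCat 𝒢)) :
    S.coveringGraph.IsConnected := by
  classical
  -- a node of the subdivision comes from a point of `S`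
  let π : S.Point → S.coveringSemiGraph.Node :=
    Sum.elim (fun x => Sum.inl ⟨x.1, BTemp.cl (S.SV x.1) x.2⟩)
      (fun y => Sum.inr (Sum.inl ⟨y.1, BTemp.cl (S.SE y.1) y.2⟩))
  have hsc : ∀ p q : S.Point, S.coveringSemiGraph.subdivision.Reachable (π p) (π q) :=
    fun p q => S.reachable_of_sameComponent (sameComponent_of_isConnectedObj ⟨S, hS⟩ hSc p q)
  -- every node is reachable from the node of a point
  have hnode : ∀ n : S.coveringSemiGraph.Node, ∃ p : S.Point,
      S.coveringSemiGraph.subdivision.Reachable (π p) n := by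
    rintro (⟨v, ω⟩ | ⟨e, ω⟩ | ⟨b, ω⟩)
    · refine ⟨Sum.inl ⟨v, Quot.out ω⟩, ?_⟩
      change S.coveringSemiGraph.subdivision.Reachable (Sum.inl ⟨v, BTemp.cl (S.SV v) (Quot.out ω)⟩) _
      rw [show BTemp.cl (S.SV v) (Quot.out ω) = ω from Quot.out_eq ω]
    · refine ⟨Sum.inr ⟨e, Quot.out ω⟩, ?_⟩
      change S.coveringSemiGraph.subdivision.Reachable
        (Sum.inr (Sum.inl ⟨e, BTemp.cl (S.SE e) (Quot.out ω)⟩)) _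
      rw [show BTemp.cl (S.SE e) (Quot.out ω) = ω from Quot.out_eq ω]
    · refine ⟨Sum.inr ⟨𝒢.graph.edgeOf b, Quot.out ω⟩, ?_⟩
      change S.coveringSemiGraph.subdivision.Reachable
        (Sum.inr (Sum.inl ⟨𝒢.graph.edgeOf b, BTemp.cl (S.SE (𝒢.graph.edgeOf b)) (Quot.out ω)⟩)) _
      rw [show BTemp.cl (S.SE (𝒢.graph.edgeOf b)) (Quot.out ω) = ω from Quot.out_eq ω]
      have : S.coveringSemiGraph.subdivision.Adj
          (Sum.inr (Sum.inl (S.coveringSemiGraph.edgeOf ⟨b, ω⟩))) (Sum.inr (Sum.inr ⟨b, ω⟩)) := by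
        rw [SemiGraph.subdivision, SimpleGraph.fromRel_adj]
        exact ⟨by simp, Or.inl (SemiGraph.NodeRel.edge_branch _)⟩
      exact this.reachable
  obtain ⟨x⟩ := nonempty_point_of_isConnectedObj ⟨S, hS⟩ hSc
  haveI : Nonempty S.coveringSemiGraph.Node := ⟨π x⟩
  refine ⟨SimpleGraph.Connected.mk fun n n' => ?_⟩
  obtain ⟨p, hp⟩ := hnode n
  obtain ⟨q, hq⟩ := hnode n'
  exact hp.symm.trans ((hsc p q).trans hq)

end CovObj

end ProfiniteSemiGraph

end Literature.AnabelianGeometry.SemiGraphs
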